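import Mathlib
import HarnessLib.Audit
import Summits.PneNP.PneNP.Theorems.PstarNorCoreTools
import Summits.PneNP.PneNP.Theorems.PstarRankRigidityTwo
import Summits.PneNP.PneNP.Theorems.PstarRankRigidityThree

/-!
# R3: the AND-sum of a path or cycle family has rank at least four (ROUND-24, memo `CORE-BOUND-NOTES.md` §4 G2′ / §9 R3 / §11 (N4))

FRONTIER range-avoidance ladder, rung F-N3, ROUND 24 (cell `pnp-ideate`, planner memo `r24/CORE-BOUND-NOTES.md` §9 R3 ("every live fundamental
path sum `Q_{P_e}` has `𝔽₂`-rank `≥ 4`: rank 2 ⟹ complete tripartite monomial set ⟹ one edge or an expansion-dead bundle") and §11 (N4) (the same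
for cycle polynomials); restricted-model proof complexity — nothing here bears on `P` versus `NP`).

For a family `P` of outputs of a pure `P⋆` instance with simple overlaps, the AND-SUM `Q_P(a) = Σ_{j ∈ P} a_{α_j} a_{β_j}` has polar form
`B_P = polar P α β` (`PstarProductRank`), and `B_P(e_c, e_d) = [some output of P has AND pair {c, d}]` (`polar_basis`; the AND pairs of distinct
outputs are distinct by simple overlaps, `andPair_ne`).  If `B_P` has RANK TWO then (`PstarRankRigidityThree.rank_two_structure`) adjacency is
given by labels in `𝔽₂²` — complete tripartite — and a counting of labels shows (`star_or_shared_of_rank_two`): either ONE variable lies in the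
AND pair of every output of `P` (a star), or EVERY AND variable of `P` lies in at least two outputs of `P`.  In the second case no AND variable
of `P` is a boundary variable of `P`; so if `P` has at most two boundary variables outside its AND pairs (an XOR-path family: the two end
vertices; an XOR-cycle family: none) then `3·#P ≤ 4` by `(r, 3/2)`-expansion.  Hence

* `rank_four_of_family` — **R3**: `#P ≥ 2`, `#P ≤ r`, no common AND variable, at most two non-AND boundary variables ⟹
  `dim rad B_P + 4 ≤ n`, the rank hypothesis of `PstarForcing.forcing_cases` / `PstarChordForcing.zeros_meet` for path forms.
-/

set_option linter.dupNamespace false -- `Summit.PneNP.PneNP.…`: summit = sub-problem name (D-0017 single-conjunct layout)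

open Finset Module Literature.Computability.Complexity
open Summit.PneNP.PneNP.Theorems.PstarSALevel (varSet bdry BoundaryExpanding SimpleOverlap)
open Summit.PneNP.PneNP.Theorems.PstarGapLinearised (andPair andPair_subset_varSet)
open Summit.PneNP.PneNP.Theorems.PstarChordEndgameTools (not_two_shared mem_andPair_iff)
open Summit.PneNP.PneNP.Theorems.PstarCentreFree (vars_mem_varSet)
open Summit.PneNP.PneNP.Theorems.PstarNorCoreTools (not_mem_bdry_of_two)
open Summit.PneNP.PneNP.Theorems.PstarProductRank (qform polar polar_apply qform_add)
open Summit.PneNP.PneNP.Theorems.PstarQuadRank (rad mem_rad finrank_rad_add_two_le)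
open Summit.PneNP.PneNP.Theorems.PstarRankRigidityTwo (even_rank)
open Summit.PneNP.PneNP.Theorems.PstarRankRigidityThree (rank_two_structure)

namespace Summit.PneNP.PneNP.Theorems.PstarPathRank

/-- In `𝔽₂`, `x + x = 0`. -/
private theorem zmod2_add_self (x : ZMod 2) : x + x = 0 := by
  revert x; decide

variable {n m : ℕ}

/-- `c, d` are AND-ADJACENT in `P`: some output of `P` has AND pair `{c, d}` (reducible, so that it is decidable). -/
abbrev AndAdj (I : LocalMap 4 n m) (P : Finset (Fin m)) (c d : Fin n) : Prop :=
  ∃ j ∈ P, (I.vars j 2 = c ∧ I.vars j 3 = d) ∨ (I.vars j 2 = d ∧ I.vars j 3 = c)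

/-! ## The adjacency form of the AND-sum -/

/-- The two AND variables of an output are distinct (purity). -/
theorem and_ne (I : LocalMap 4 n m) (hI : I.IsPure xorAndPred) (j : Fin m) : I.vars j 2 ≠ I.vars j 3 :=
  fun h => absurd (hI.2 j h) (by decide)

/-- **Distinct outputs have distinct AND pairs** (simple overlaps). -/
theorem andPair_ne (I : LocalMap 4 n m) (hI : I.IsPure xorAndPred) (hS : SimpleOverlap I) {j j' : Fin m} (hne : j ≠ j') :
    ¬ ((I.vars j 2 = I.vars j' 2 ∧ I.vars j 3 = I.vars j' 3) ∨ (I.vars j 2 = I.vars j' 3 ∧ I.vars j 3 = I.vars j' 2)) := by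
  rintro (⟨h2, h3⟩ | ⟨h2, h3⟩)
  · exact not_two_shared I hS hne (and_ne I hI j) (vars_mem_varSet I j 2) (h2 ▸ vars_mem_varSet I j' 2) (vars_mem_varSet I j 3)
      (h3 ▸ vars_mem_varSet I j' 3)
  · exact not_two_shared I hS hne (and_ne I hI j) (vars_mem_varSet I j 2) (h2 ▸ vars_mem_varSet I j' 3) (vars_mem_varSet I j 3)
      (h3 ▸ vars_mem_varSet I j' 2)

/-- Product of two indicators. -/
private theorem ind_mul (A C : Prop) [Decidable A] [Decidable C] :
    ((if A then (1 : ZMod 2) else 0) * if C then 1 else 0) = if A ∧ C then 1 else 0 := by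
  by_cases hA : A <;> by_cases hC : C <;> simp [hA, hC]

/-- **`B_P(e_c, e_d) = [c, d AND-adjacent in P]`.** -/
theorem polar_basis (I : LocalMap 4 n m) (hI : I.IsPure xorAndPred) (hS : SimpleOverlap I) (P : Finset (Fin m)) (c d : Fin n) :
    polar P (fun j => I.vars j 2) (fun j => I.vars j 3) (Pi.single c (1 : ZMod 2)) (Pi.single d 1) =
      if AndAdj I P c d then 1 else 0 := by
  classical
  rw [polar_apply]
  -- each summand is the indicator of "output `j` has AND pair `{c, d}`"
  have hterm : ∀ j ∈ P, ((Pi.single c 1 : Fin n → ZMod 2) (I.vars j 2) * (Pi.single d 1 : Fin n → ZMod 2) (I.vars j 3) +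
      (Pi.single c 1 : Fin n → ZMod 2) (I.vars j 3) * (Pi.single d 1 : Fin n → ZMod 2) (I.vars j 2)) =
      if (I.vars j 2 = c ∧ I.vars j 3 = d) ∨ (I.vars j 2 = d ∧ I.vars j 3 = c) then 1 else 0 := by
    intro j _
    simp only [Pi.single_apply]
    rw [ind_mul, ind_mul]
    have hne := and_ne I hI j
    by_cases h1 : I.vars j 2 = c ∧ I.vars j 3 = d
    · have h2 : ¬ (I.vars j 3 = c ∧ I.vars j 2 = d) := fun h => hne (by rw [h1.1, ← h.1])
      rw [if_pos h1, if_neg h2, add_zero, if_pos (Or.inl h1)]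
    · by_cases h2 : I.vars j 3 = c ∧ I.vars j 2 = d
      · rw [if_neg h1, if_pos h2, zero_add, if_pos (Or.inr ⟨h2.2, h2.1⟩)]
      · rw [if_neg h1, if_neg h2, add_zero, if_neg (fun h => h.elim h1 fun h => h2 ⟨h.2, h.1⟩)]
  rw [sum_congr rfl hterm, sum_boole]
  -- at most one output has AND pair `{c, d}`
  have hle : (P.filter fun j => (I.vars j 2 = c ∧ I.vars j 3 = d) ∨ (I.vars j 2 = d ∧ I.vars j 3 = c)).card ≤ 1 := by
    refine card_le_one.2 fun j hj j' hj' => ?_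
    rw [mem_filter] at hj hj'
    by_contra hjj
    refine andPair_ne I hI hS hjj ?_
    rcases hj.2 with ⟨a2, a3⟩ | ⟨a2, a3⟩ <;> rcases hj'.2 with ⟨b2, b3⟩ | ⟨b2, b3⟩
    · exact Or.inl ⟨a2.trans b2.symm, a3.trans b3.symm⟩
    · exact Or.inr ⟨a2.trans b3.symm, a3.trans b2.symm⟩
    · exact Or.inr ⟨a2.trans b3.symm, a3.trans b2.symm⟩
    · exact Or.inl ⟨a2.trans b2.symm, a3.trans b3.symm⟩
  by_cases hA : AndAdj I P c d
  · rw [if_pos hA]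
    obtain ⟨j, hj, hj'⟩ := hA
    have h1 : (P.filter fun j => (I.vars j 2 = c ∧ I.vars j 3 = d) ∨ (I.vars j 2 = d ∧ I.vars j 3 = c)).card = 1 := by
      refine le_antisymm hle (card_pos.2 ⟨j, mem_filter.2 ⟨hj, hj'⟩⟩)
    rw [h1, Nat.cast_one]
  · rw [if_neg hA]
    have h0 : (P.filter fun j => (I.vars j 2 = c ∧ I.vars j 3 = d) ∨ (I.vars j 2 = d ∧ I.vars j 3 = c)).card = 0 := by
      refine card_eq_zero.2 (filter_eq_empty_iff.2 fun j hj h => hA ⟨j, hj, h⟩)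
    rw [h0, Nat.cast_zero]

/-- The AND-sum's polar form is alternating. -/
theorem polar_self_and (I : LocalMap 4 n m) (P : Finset (Fin m)) (x : Fin n → ZMod 2) :
    polar P (fun j => I.vars j 2) (fun j => I.vars j 3) x x = 0 := by
  rw [polar_apply]
  exact sum_eq_zero fun j _ => by rw [mul_comm (x (I.vars j 3))]; exact zmod2_add_self _

/-- The AND-sum's polar form is symmetric. -/
theorem polar_symm_and (I : LocalMap 4 n m) (P : Finset (Fin m)) (x y : Fin n → ZMod 2) :
    polar P (fun j => I.vars j 2) (fun j => I.vars j 3) x y = polar P (fun j => I.vars j 2) (fun j => I.vars j 3) y x := by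
  rw [polar_apply, polar_apply]
  exact sum_congr rfl fun j _ => by ring

/-! ## Rank two: labels, complete tripartite, star or shared -/

section RankTwo

variable {I : LocalMap 4 n m} (hI : I.IsPure xorAndPred) (hS : SimpleOverlap I) {P : Finset (Fin m)} {a b : Fin n → ZMod 2}
  (hab : polar P (fun j => I.vars j 2) (fun j => I.vars j 3) a b = 1)
  (hrank : finrank (ZMod 2) (Fin n → ZMod 2) ≤ finrank (ZMod 2) (rad (polar P (fun j => I.vars j 2) (fun j => I.vars j 3))) + 2)

include hI hS hab hrank

/-- **Adjacency from labels** (rank two): with `u_c = B_P(e_c, b)`, `ℓ_c = B_P(e_c, a)`, `c, d` are AND-adjacent iff `u_c ℓ_d + u_d ℓ_c = 1`. -/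
theorem andAdj_iff_labels (c d : Fin n) :
    AndAdj I P c d ↔
      polar P (fun j => I.vars j 2) (fun j => I.vars j 3) (Pi.single c 1) b * polar P (fun j => I.vars j 2) (fun j => I.vars j 3) (Pi.single d 1) a +
      polar P (fun j => I.vars j 2) (fun j => I.vars j 3) (Pi.single d 1) b * polar P (fun j => I.vars j 2) (fun j => I.vars j 3) (Pi.single c 1) a
        = 1 := by
  classical
  have h := rank_two_structure (polar_self_and I P) (polar_symm_and I P) hab hrank (Pi.single c (1 : ZMod 2)) (Pi.single d 1)
  rw [polar_basis I hI hS] at h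
  by_cases hA : AndAdj I P c d
  · rw [if_pos hA] at h; exact ⟨fun _ => h.symm, fun _ => hA⟩
  · rw [if_neg hA] at h
    refine ⟨fun h' => absurd h' hA, fun h' => ?_⟩
    rw [← h] at h'; exact absurd h' zero_ne_one

/-- **Complete tripartite structure** (rank two): `c, d` are AND-adjacent iff their labels are non-zero and different. -/
theorem andAdj_iff_labels_ne (c d : Fin n) :
    AndAdj I P c d ↔
      (polar P (fun j => I.vars j 2) (fun j => I.vars j 3) (Pi.single c 1) b, polar P (fun j => I.vars j 2) (fun j => I.vars j 3) (Pi.single c 1) a)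
          ≠ (0, 0) ∧
      (polar P (fun j => I.vars j 2) (fun j => I.vars j 3) (Pi.single d 1) b, polar P (fun j => I.vars j 2) (fun j => I.vars j 3) (Pi.single d 1) a)
          ≠ (0, 0) ∧
      (polar P (fun j => I.vars j 2) (fun j => I.vars j 3) (Pi.single c 1) b, polar P (fun j => I.vars j 2) (fun j => I.vars j 3) (Pi.single c 1) a)
        ≠ (polar P (fun j => I.vars j 2) (fun j => I.vars j 3) (Pi.single d 1) b,
            polar P (fun j => I.vars j 2) (fun j => I.vars j 3) (Pi.single d 1) a) := by
  rw [andAdj_iff_labels hI hS hab hrank]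
  generalize polar P (fun j => I.vars j 2) (fun j => I.vars j 3) (Pi.single c 1) b = uc
  generalize polar P (fun j => I.vars j 2) (fun j => I.vars j 3) (Pi.single c 1) a = lc
  generalize polar P (fun j => I.vars j 2) (fun j => I.vars j 3) (Pi.single d 1) b = ud
  generalize polar P (fun j => I.vars j 2) (fun j => I.vars j 3) (Pi.single d 1) a = ld
  revert uc lc ud ld
  decide

/-- **Star or shared** (rank two): either one variable lies in the AND pair of every output of `P`, or every AND variable of `P` lies in at
least two outputs of `P`. -/
theorem star_or_shared_of_rank_two :
    (∃ d : Fin n, ∀ j ∈ P, d ∈ andPair I j) ∨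
    (∀ j₀ ∈ P, ∀ s : Fin 4, 2 ≤ s.val → ∃ j ∈ P, j ≠ j₀ ∧ I.vars j₀ s ∈ andPair I j) := by
  classical
  -- abbreviate the label of a variable
  let L : Fin n → ZMod 2 × ZMod 2 := fun c =>
    (polar P (fun j => I.vars j 2) (fun j => I.vars j 3) (Pi.single c 1) b, polar P (fun j => I.vars j 2) (fun j => I.vars j 3) (Pi.single c 1) a)
  have key : ∀ c d, AndAdj I P c d ↔ L c ≠ (0, 0) ∧ L d ≠ (0, 0) ∧ L c ≠ L d := fun c d => andAdj_iff_labels_ne hI hS hab hrank c d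
  have adj_of_mem : ∀ j ∈ P, AndAdj I P (I.vars j 2) (I.vars j 3) := fun j hj => ⟨j, hj, Or.inl ⟨rfl, rfl⟩⟩
  by_cases hsh : ∀ j₀ ∈ P, ∀ s : Fin 4, 2 ≤ s.val → ∃ j ∈ P, j ≠ j₀ ∧ I.vars j₀ s ∈ andPair I j
  · exact Or.inr hsh
  left
  push Not at hsh
  obtain ⟨j₀, hj₀, s, hs, hpriv⟩ := hsh
  -- `c := vars j₀ s` lies only in `j₀`; `d` := its partner
  have hs23 : s = 2 ∨ s = 3 := by
    have h4 : ∀ t : Fin 4, 2 ≤ t.val → t = 2 ∨ t = 3 := by decide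
    exact h4 s hs
  obtain ⟨c, d, hcd, hc_only⟩ : ∃ c d : Fin n, ((I.vars j₀ 2 = c ∧ I.vars j₀ 3 = d) ∨ (I.vars j₀ 2 = d ∧ I.vars j₀ 3 = c)) ∧
      ∀ j ∈ P, j ≠ j₀ → c ∉ andPair I j := by
    rcases hs23 with rfl | rfl
    · exact ⟨I.vars j₀ 2, I.vars j₀ 3, Or.inl ⟨rfl, rfl⟩, fun j hj hne => hpriv j hj hne⟩
    · exact ⟨I.vars j₀ 3, I.vars j₀ 2, Or.inr ⟨rfl, rfl⟩, fun j hj hne => hpriv j hj hne⟩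
  have hadj_cd : AndAdj I P c d := ⟨j₀, hj₀, hcd⟩
  obtain ⟨hLc, hLd, hLcd⟩ := (key c d).1 hadj_cd
  -- any variable adjacent to `c` is `d`
  have only_d : ∀ x, AndAdj I P c x → x = d := by
    rintro x ⟨j, hj, hx⟩
    by_cases hjj : j = j₀
    · subst hjj
      have hne := and_ne I hI j
      rcases hcd with ⟨h2, h3⟩ | ⟨h2, h3⟩ <;> rcases hx with ⟨g2, g3⟩ | ⟨g2, g3⟩
      · exact g3.symm.trans h3
      · exact absurd (h2.trans g3.symm) hne
      · exact absurd (g2.trans h3.symm) hne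
      · exact g2.symm.trans h2
    · exfalso
      refine hc_only j hj hjj ((mem_andPair_iff I j c).2 ?_)
      rcases hx with ⟨g2, -⟩ | ⟨-, g3⟩
      · exact Or.inl g2.symm
      · exact Or.inr g3.symm
  -- so every AND variable `x ≠ d` of `P` with `x ≠ c` has the label of `c`
  have same_label : ∀ x, (∃ j ∈ P, x ∈ andPair I j) → x ≠ c → x ≠ d → L x = L c := by
    rintro x ⟨j, hj, hx⟩ hxc hxd
    -- `x` has a non-zero label (it is on an edge)
    have hLx : L x ≠ (0, 0) := by
      rcases (mem_andPair_iff I j x).1 hx with rfl | rfl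
      · exact ((key _ _).1 (adj_of_mem j hj)).1
      · exact ((key _ _).1 (adj_of_mem j hj)).2.1
    by_contra hne
    exact hxd (only_d x ((key c x).2 ⟨hLc, hLx, fun h => hne h.symm⟩))
  -- every output other than `j₀` contains `d`
  refine ⟨d, fun j hj => ?_⟩
  by_cases hjj : j = j₀
  · subst hjj
    rcases hcd with ⟨-, h3⟩ | ⟨h2, -⟩
    · exact (mem_andPair_iff I j d).2 (Or.inr h3.symm)
    · exact (mem_andPair_iff I j d).2 (Or.inl h2.symm)
  · by_contra hd
    have hx2 : I.vars j 2 ≠ c := fun h => hc_only j hj hjj ((mem_andPair_iff I j c).2 (Or.inl h.symm))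
    have hx3 : I.vars j 3 ≠ c := fun h => hc_only j hj hjj ((mem_andPair_iff I j c).2 (Or.inr h.symm))
    have hd2 : I.vars j 2 ≠ d := fun h => hd ((mem_andPair_iff I j d).2 (Or.inl h.symm))
    have hd3 : I.vars j 3 ≠ d := fun h => hd ((mem_andPair_iff I j d).2 (Or.inr h.symm))
    have e2 := same_label (I.vars j 2) ⟨j, hj, (mem_andPair_iff I j _).2 (Or.inl rfl)⟩ hx2 hd2
    have e3 := same_label (I.vars j 3) ⟨j, hj, (mem_andPair_iff I j _).2 (Or.inr rfl)⟩ hx3 hd3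
    exact ((key _ _).1 (adj_of_mem j hj)).2.2 (e2.trans e3.symm)

end RankTwo

/-! ## R3 -/

/-- **R3 — the AND-sum of a path/cycle family has rank at least four.**  `P`: at least two and at most `r` outputs of a pure `(r,3/2)`-expanding
instance with simple overlaps, with no variable common to all AND pairs of `P` (for an XOR path: consecutive outputs share an XOR variable, so not
an AND variable) and at most two boundary variables of `P` outside the AND pairs of `P` (XOR path: its two ends; XOR cycle: none).  Then the
polar form of `Q_P = Σ_{j∈P} a_{α_j} a_{β_j}` has radical of codimension `≥ 4`. -/
theorem rank_four_of_family (I : LocalMap 4 n m) (hI : I.IsPure xorAndPred) (hS : SimpleOverlap I) {r : ℕ} (hB : BoundaryExpanding r I)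
    {P : Finset (Fin m)} (h2 : 2 ≤ P.card) (hr : P.card ≤ r) (hstar : ¬ ∃ d : Fin n, ∀ j ∈ P, d ∈ andPair I j)
    (hxor : ((bdry I P).filter fun v => ∀ j ∈ P, v ∉ andPair I j).card ≤ 2) :
    finrank (ZMod 2) (rad (polar P (fun j => I.vars j 2) (fun j => I.vars j 3))) + 4 ≤ finrank (ZMod 2) (Fin n → ZMod 2) := by
  classical
  set B : LinearMap.BilinForm (ZMod 2) (Fin n → ZMod 2) := polar P (fun j => I.vars j 2) (fun j => I.vars j 3) with hBdef
  -- `B ≠ 0`: any output of `P` gives an adjacent pair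
  obtain ⟨j₀, hj₀⟩ : P.Nonempty := card_pos.1 (by omega)
  have hab : B (Pi.single (I.vars j₀ 2) 1) (Pi.single (I.vars j₀ 3) 1) = 1 := by
    rw [hBdef, polar_basis I hI hS, if_pos ⟨j₀, hj₀, Or.inl ⟨rfl, rfl⟩⟩]
  have h2le : finrank (ZMod 2) (rad B) + 2 ≤ finrank (ZMod 2) (Fin n → ZMod 2) :=
    finrank_rad_add_two_le (polar_self_and I P) (polar_symm_and I P) (by rw [hab]; exact one_ne_zero)
  -- the rank is even
  have hq : ∀ x w : Fin n → ZMod 2, qform P (fun j => I.vars j 2) (fun j => I.vars j 3) (x + w) =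
      qform P (fun j => I.vars j 2) (fun j => I.vars j 3) x + qform P (fun j => I.vars j 2) (fun j => I.vars j 3) w +
        qform P (fun j => I.vars j 2) (fun j => I.vars j 3) 0 + B x w := by
    intro x w
    have hz : qform P (fun j => I.vars j 2) (fun j => I.vars j 3) (0 : Fin n → ZMod 2) = 0 := by
      simp only [qform, Pi.zero_apply, mul_zero, sum_const_zero]
    rw [qform_add, hz, add_zero]
  have heven := even_rank hq
  by_contra h4
  -- so the rank is exactly two
  have hrank : finrank (ZMod 2) (Fin n → ZMod 2) ≤ finrank (ZMod 2) (rad B) + 2 := by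
    rcases heven with ⟨k, hk⟩
    omega
  rcases star_or_shared_of_rank_two hI hS hab hrank with hst | hsh
  · exact hstar hst
  · -- every AND variable of `P` is shared inside `P`: the boundary of `P` avoids the AND pairs
    have hbd : bdry I P ⊆ (bdry I P).filter fun v => ∀ j ∈ P, v ∉ andPair I j := by
      intro v hv
      refine mem_filter.2 ⟨hv, fun j hj hvj => ?_⟩
      rcases (mem_andPair_iff I j v).1 hvj with rfl | rfl
      · obtain ⟨j', hj', hne, hm⟩ := hsh j hj 2 (by decide)
        exact not_mem_bdry_of_two I hj hj' hne.symm (vars_mem_varSet I j 2) (andPair_subset_varSet I j' hm) hv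
      · obtain ⟨j', hj', hne, hm⟩ := hsh j hj 3 (by decide)
        exact not_mem_bdry_of_two I hj hj' hne.symm (vars_mem_varSet I j 3) (andPair_subset_varSet I j' hm) hv
    have hexp := hB P hr
    have := card_le_card hbd
    omega

end Summit.PneNP.PneNP.Theorems.PstarPathRank
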